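import Literature.MathematicalPhysics.QuantumFieldTheory.ConformalBootstrap3D.SigmaEpsilonSystem
import HarnessLib

/-!
# The `O(N)` archipelago system `⟨φφφφ⟩, ⟨φφss⟩, ⟨ssss⟩` in three dimensions (typed axioms)

Topic `MathematicalPhysics/QuantumFieldTheory`; definitions + elementary theorems only (no named fact,
no instance, no `sorry`).  The `O(N)` analogue of `ConformalBootstrap3D/SigmaEpsilonSystem.lean`:
statement-level typing of the hypotheses under which the `O(N)` "islands" in the `(Δ_φ, Δ_s)` plane are
derived — F. Kos, D. Poland, D. Simmons-Duffin, A. Vichi, *Bootstrapping the O(N) archipelago*, JHEP 11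
(2015) 106 [KosPolandSimmonsDuffinVichi2015], §2.1–2.2 and §3 — so that a CERTIFIED dual-functional
exclusion can be stated as a theorem `ArchipelagoEnclosure N A W R` about exactly these hypotheses and
nothing stronger.  Nothing here constructs a CFT, evaluates a block, or asserts an island.

THE SYSTEM (source §2.1, read from the held text `paper:arxiv-1504.07997`).  `φ_i` is an `O(N)`-vector
scalar of dimension `Δ_φ`, `s` the lowest singlet scalar, dimension `Δ_s`.  The OPE `φ_i × φ_j` contains
even-spin singlets `S⁺` (among them `𝟙` and `s`), even-spin traceless symmetric tensors `T⁺` and odd-spin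
antisymmetric tensors `A⁻`; `s × s` contains even-spin singlets; `φ_i × s` contains `O(N)` vectors `V` of
every spin (among them `φ_i` itself).  Crossing symmetry of `⟨φ_iφ_jφ_kφ_l⟩`, `⟨φ_iφ_j s s⟩`, `⟨ssss⟩` is
"a system of seven equations" `Σ_S (λ_{φφ𝒪} λ_{ss𝒪}) V⃗_S (λ_{φφ𝒪}; λ_{ss𝒪}) + Σ_T λ² V⃗_T + Σ_A λ² V⃗_A
+ Σ_V λ² V⃗_V = 0` [cite: KosPolandSimmonsDuffinVichi2015, §2.1 (seven equations; `V⃗_T, V⃗_A, V⃗_V,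
V⃗_S`)]; its channel-sum-level algebra over opaque channel functions of `(u,v)` is
`ONMixedSumRule.lean` (+ `ONOPEAngleScan.lean` for the external-operator term).  THIS file types the
DATA and the AXIOMS in the `z`-coordinates and block conventions of the `σ–ε` files (`crossF`,
`IsConformalBlock3D`, `unitarityBound3D` of `SigmaEpsilonSystem.lean`), sector by sector:

* `ArchipelagoData N` — external dimensions `Δ_φ, Δ_s`; the EXTERNAL operators' own OPE data, kept apart
  because the island needs them coupled (§2.2: "the equality of the OPE coefficients `λ_{φφs} = λ_{φsφ}` …
  It is important that `φ` and `s` be isolated"): `λ_{φφs}, λ_{sss}, λ_{φsφ}` and the three block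
  functions `g^{0,0}_{Δ_s,0}` (for `s ∈ φ×φ, s×s`), `g^{Δ_φs,Δ_φs}_{Δ_φ,0}`, `g^{-Δ_φs,Δ_φs}_{Δ_φ,0}` (for
  `φ ∈ φ×s`; `Δ_φs = Δ_φ - Δ_s`); then four indexed families — `S` (even-spin singlets OTHER than `𝟙` and
  `s`, real couplings `λ_{φφ𝒪}, λ_{ss𝒪}`, block `g^{0,0}`), `T` and `A` (coupling `λ_{φφ𝒪}`, block
  `g^{0,0}`), `V` (vectors OTHER than `φ`, coupling `λ_{φs𝒪}`, the two block functions `g^{±Δ_φs,Δ_φs}`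
  that `⟨φsφs⟩` and `⟨sφφs⟩` need — verbatim the `ℤ₂`-odd sector of `SigmaEpsilonData` with
  `(σ, ε) ↦ (φ, s)`).  The identity is not an index (`λ_{φφ𝟙} = λ_{ss𝟙} = 1`, block `1`).
* A2 `HasGenuineBlocks`, A1 `SatisfiesUnitarity` (+ the diagonal convergence clause
  `HasConvergentWeights`, as in the `σ–ε` file: needed only by derivative functionals), A3
  `SatisfiesCrossing` (the seven sum rules at every real point of the square `z, z̄ ∈ (0,1)`, as `HasSum`
  identities), A4 `SatisfiesGaps` (the spectral assumptions, PARAMETRISED: `ArchipelagoGaps`), A5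
  `OPESymmetric` (`λ_{φsφ} = λ_{φφs}`); conjoined in `SatisfiesBootstrapAxioms`.
* `ArchipelagoEnclosure N A W R` / `BoxExcluded N A Q` and their elementary closure properties
  (`mono`, `inter`, `union`, `of_cover`) — the shape in which box-by-box certificates assemble.

SIGN AND NORMALISATION CONVENTIONS (the only delicate point; every product `(coefficient) × (block)` below
is convention-free, the factors are not).  Blocks are those of A2: `c_ℓ = 1`, non-negative double series
for `Δ₁₂ = -Δ₃₄` (`HasLeadingPart`).  (i) `⟨φφφφ⟩` rows.  The source follows "the conformal block
conventions of [Kos–Poland–Simmons-Duffin 2014, Ising], which contain a factor of `(−1)^ℓ` relative to the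
conventions used in the previous global symmetry studies … This leads to a different sign in front of the
contributions of the `𝒪_A` operators" [cite: KosPolandSimmonsDuffinVichi2015, §2.1 (footnote on
conventions)]; the Ising-convention block is `(−1)^ℓ κ_{Δ,ℓ} g^{A2}_{Δ,ℓ}` with `κ > 0`
(`SigmaEpsilonSystem`, docstring of `HasLeadingPart`), so the 2014 `O(N)` blocks are POSITIVE multiples
of the A2 blocks and rows 1–3 are written in the 2014 form `V_S = (0, F⁻, F⁺)`,
`V_T = (F⁻, (1−2/N)F⁻, −(1+2/N)F⁺)`, `V_A = (−F⁻, F⁻, −F⁺)` [cite: KosPolandSimmonsduffin2014ON, §2.1]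
(`ONVectorSumRule.VS/VT/VA`; the source's rows are these with `G_A ↦ −G_A`,
`ONMixedSumRule.crossingPhi4At_iff`).  Check: for the free `O(N)` vector (`Δ_φ = 1/2`) the coefficient of
the antisymmetric structure `δ_il δ_jk − δ_ik δ_jl` (`ONVectorSumRule.tA`) in `x₁₂x₃₄ ⟨φφφφ⟩` is
`(u^{1/2} v^{-1/2} − u^{1/2})/2 = +¼ u^{1/2}(z + z̄) + …`, a POSITIVE multiple of the leading A2 block
`g_{2,1} = u^{1/2}(z + z̄) + …` of the conserved current, as `λ² > 0` requires.  (ii) `V` rows.  The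
correlators `⟨φ_i s φ_j s⟩`, `⟨φ_i φ_j s s⟩` carry the single invariant tensor `δ_ij`; their rows are the
`ℤ₂`-odd rules 3–5 of `SigmaEpsilonData.SatisfiesCrossing` with `(σ, ε) ↦ (φ, s)`, and the spin-parity
sign is placed as there (ERRATUM 2026-08-19 of that docstring, checked against two decoupled generalised
free fields): `(−1)^ℓ λ²` on the `⟨φsφs⟩` family `g^{Δ_φs,Δ_φs}` (rule 5 here), `+λ²` on the
reflection-positive `⟨sφφs⟩` family `g^{-Δ_φs,Δ_φs}` (rules 6–7).  The source prints `V⃗_V = (0,0,0,0,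
F^{φs,φs}_-, (−1)^ℓ F^{sφ,φs}_-, −(−1)^ℓ F^{sφ,φs}_+)` for ITS blocks; multiplying by the positive `κ`
and moving `(−1)^ℓ` across gives the placement used here.  (iii) A5.  "In writing this constraint, we have
assumed the scalar conformal blocks are normalized so that `g_{Δ,ℓ}(u,v) ∼ C u^{Δ/2}` to leading order in
`u`, where `C` is a `Δ`-independent constant" [cite: KosPolandSimmonsDuffinVichi2015, §2.2 (footnote on
normalisation)] — the A2 normalisation has `C = 1` for every `(Δ₁₂, Δ₃₄)` (`HasLeadingPart`, `ℓ = 0`).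

WHAT THE AXIOMS DO NOT SAY (deliberately, as in the `σ–ε` file): which operators exist beyond these
three correlators; `SO(N)` versus `O(N)` (§2.1.1: for `N = 2, 3, 4` the representation ring has
coincidences, analysed in the source with the conclusion "((eq:vectoreq)) and the semidefinite program
discussed below remain valid in the case of `SO(N)` symmetry"); the symmetric-tensor correlators `⟨t t …⟩` of later work; anything numerical (§3–§4,
the islands, `Λ = 19, 27, 35`).  The gap values of the source (`Δ_{s'} ≥ 3`, `Δ_{φ'} ≥ 3`, optionally
`Δ_{t'}`) are not hard-wired: `ArchipelagoGaps` carries three real thresholds, `1/2` meaning "no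
assumption".  The printed islands are floating-point SDPB results, not instances of `ArchipelagoEnclosure`.
-/

namespace Literature.MathematicalPhysics.QuantumFieldTheory.ONArchipelagoSystem

open Set
open ConformalBootstrap3D (IsConformalBlock3D unitarityBound3D crossF)

noncomputable section

/-! ### §1 The datum -/

/-- **`O(N)` archipelago datum** — what the semidefinite programme of the cited §2.2 sees of a CFT with an
`O(N)`-vector scalar `φ_i` and a singlet scalar `s`.  External dimensions `Δ_φ, Δ_s`; the external
operators' own couplings `λ_{φφs}` (`s ∈ φ×φ`), `λ_{sss}` (`s ∈ s×s`), `λ_{φsφ}` (`φ ∈ φ×s`) with the block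
functions `gs = g^{0,0}_{Δ_s,0}`, `gφm = g^{Δ_φs,Δ_φs}_{Δ_φ,0}` (entering `⟨φsφs⟩`),
`gφp = g^{-Δ_φs,Δ_φs}_{Δ_φ,0}` (entering `⟨sφφs⟩`); `ιS` indexes the even-spin singlets OTHER than `𝟙` and
`s` exchanged in `φ×φ` or `s×s` (dimension, spin, real couplings `λ_{φφ𝒪}`, `λ_{ss𝒪}` — an operator absent
from one OPE has that coupling `0` — and block `g^{0,0}_{Δ,ℓ}`); `ιT` the traceless symmetric tensors and
`ιA` the antisymmetric tensors of `φ×φ` (`λ_{φφ𝒪}`, block `g^{0,0}`); `ιV` the `O(N)` vectors OTHER than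
`φ` exchanged in `φ×s` (`λ_{φs𝒪}` and the two block functions `gVm = g^{Δ_φs,Δ_φs}_{Δ,ℓ}`,
`gVp = g^{-Δ_φs,Δ_φs}_{Δ,ℓ}`).  Hypothesis structure: the axioms are the predicates below.
[cite: KosPolandSimmonsDuffinVichi2015, §2.1 (seven equations; `V⃗_T, V⃗_A, V⃗_V, V⃗_S`)] -/
structure ArchipelagoData (N : ℕ) where
  /-- `Δ_φ`, the dimension of the `O(N)`-vector scalar `φ_i`. -/
  Δφ : ℝ
  /-- `Δ_s`, the dimension of the singlet scalar `s`. -/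
  Δs : ℝ
  /-- `λ_{φφs}`. -/
  lamφφs : ℝ
  /-- `λ_{sss}`. -/
  lamsss : ℝ
  /-- `λ_{φsφ}`. -/
  lamφsφ : ℝ
  /-- `g^{0,0}_{Δ_s,0}(z, z̄)`, the block of `s` in `⟨φφφφ⟩`, `⟨φφss⟩`, `⟨ssss⟩`. -/
  gs : ℝ → ℝ → ℝ
  /-- `g^{Δ_φs,Δ_φs}_{Δ_φ,0}(z, z̄)`, the block of `φ` in `⟨φsφs⟩`. -/
  gφm : ℝ → ℝ → ℝ
  /-- `g^{-Δ_φs,Δ_φs}_{Δ_φ,0}(z, z̄)`, the block of `φ` in `⟨sφφs⟩`. -/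
  gφp : ℝ → ℝ → ℝ
  /-- Index type of the even-spin singlets other than `𝟙`, `s`. -/
  ιS : Type
  /-- Dimensions of the singlets. -/
  ΔS : ιS → ℝ
  /-- Spins of the singlets. -/
  ℓS : ιS → ℕ
  /-- `λ_{φφ𝒪}` of the singlets. -/
  lamφφS : ιS → ℝ
  /-- `λ_{ss𝒪}` of the singlets. -/
  lamssS : ιS → ℝ
  /-- Blocks `g^{0,0}_{Δ,ℓ}` of the singlets. -/
  gS : ιS → ℝ → ℝ → ℝ
  /-- Index type of the traceless symmetric tensors of `φ×φ`. -/
  ιT : Type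
  /-- Dimensions (`T`). -/
  ΔT : ιT → ℝ
  /-- Spins (`T`). -/
  ℓT : ιT → ℕ
  /-- `λ_{φφ𝒪}` (`T`). -/
  lamT : ιT → ℝ
  /-- Blocks `g^{0,0}_{Δ,ℓ}` (`T`). -/
  gT : ιT → ℝ → ℝ → ℝ
  /-- Index type of the antisymmetric tensors of `φ×φ`. -/
  ιA : Type
  /-- Dimensions (`A`). -/
  ΔA : ιA → ℝ
  /-- Spins (`A`). -/
  ℓA : ιA → ℕ
  /-- `λ_{φφ𝒪}` (`A`). -/
  lamA : ιA → ℝ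
  /-- Blocks `g^{0,0}_{Δ,ℓ}` (`A`). -/
  gA : ιA → ℝ → ℝ → ℝ
  /-- Index type of the `O(N)` vectors of `φ×s` other than `φ`. -/
  ιV : Type
  /-- Dimensions (`V`). -/
  ΔV : ιV → ℝ
  /-- Spins (`V`). -/
  ℓV : ιV → ℕ
  /-- `λ_{φs𝒪}` (`V`). -/
  lamV : ιV → ℝ
  /-- Blocks `g^{Δ_φs,Δ_φs}_{Δ,ℓ}` (`V`, for `⟨φsφs⟩`). -/
  gVm : ιV → ℝ → ℝ → ℝ
  /-- Blocks `g^{-Δ_φs,Δ_φs}_{Δ,ℓ}` (`V`, for `⟨sφφs⟩`). -/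
  gVp : ιV → ℝ → ℝ → ℝ

/-- **The spectral assumptions, parametrised** (source §2.2: "We will often assume gaps to the
second-lowest dimension operators `s', φ_i', t_{ij}'` in each of these sectors"): every singlet SCALAR of
`ιS` has `Δ ≥ Δ_S^*`, every vector scalar of `ιV` has `Δ ≥ Δ_V^*`, every traceless-symmetric scalar has
`Δ ≥ Δ_T^*`.  The islands of §3 use `Δ_S^* = Δ_V^* = 3` ("`φ_i, s` are the only relevant scalars in their
respective sectors", eq. (example)) and either `Δ_T^* = 1/2` (no assumption) or a `t`-scan; `1/2` is "no
assumption" in every slot. [cite: KosPolandSimmonsDuffinVichi2015, §2.2 (assumptions; eq. example)] -/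
structure ArchipelagoGaps where
  /-- `Δ_S^*`: lower bound on the dimensions of the singlet scalars other than `s`. -/
  ΔSstar : ℝ
  /-- `Δ_V^*`: lower bound on the dimensions of the `O(N)`-vector scalars other than `φ`. -/
  ΔVstar : ℝ
  /-- `Δ_T^*`: lower bound on the dimensions of the traceless-symmetric scalars. -/
  ΔTstar : ℝ

namespace ArchipelagoData

variable {N : ℕ}

/-- `Δ_φs = Δ_φ - Δ_s`, the external-dimension difference of the `⟨φsφs⟩`, `⟨sφφs⟩` blocks (source §2:
"`g^{Δ_ij,Δ_kl}_{Δ,ℓ}`, `Δ_ij ≡ Δ_i − Δ_j`"). [cite: KosPolandSimmonsDuffinVichi2015, §2 (crossing equation and `F^{ij,kl}_∓`)] -/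
def Δφs (D : ArchipelagoData N) : ℝ := D.Δφ - D.Δs

/-- `h = (Δ_φ + Δ_s)/2`, the prefactor exponent of `F^{φs,φs}_∓` and `F^{φφ,ss}_∓` (source §2:
"`F^{ij,kl}_{∓} ≡ v^{(Δ_k+Δ_j)/2} g(u,v) ∓ u^{(Δ_k+Δ_j)/2} g(v,u)`").
[cite: KosPolandSimmonsDuffinVichi2015, §2 (crossing equation and `F^{ij,kl}_∓`)] -/
def Δh (D : ArchipelagoData N) : ℝ := (D.Δφ + D.Δs) / 2

/-- **A2 — genuine blocks.** Every block function of the datum is the genuine 3D block with the right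
parameters (`IsConformalBlock3D` of the `σ–ε` file: `c_ℓ = 1`, at the unitarity bound by continuity from
above): `gs = g^{0,0}_{Δ_s,0}`, `gφm = g^{Δ_φs,Δ_φs}_{Δ_φ,0}`, `gφp = g^{-Δ_φs,Δ_φs}_{Δ_φ,0}`, the `S, T, A`
blocks `g^{0,0}_{Δ,ℓ}`, the `V` blocks `g^{±Δ_φs,Δ_φs}_{Δ,ℓ}` (source §2: the blocks `g^{Δ_ij,Δ_kl}_{Δ,ℓ}`
of `⟨φ_iφ_jφ_kφ_l⟩`). [cite: KosPolandSimmonsDuffinVichi2015, §2 (crossing equation and `F^{ij,kl}_∓`)] -/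
def HasGenuineBlocks (D : ArchipelagoData N) : Prop :=
  IsConformalBlock3D 0 0 D.Δs 0 D.gs ∧ IsConformalBlock3D D.Δφs D.Δφs D.Δφ 0 D.gφm ∧
    IsConformalBlock3D (-D.Δφs) D.Δφs D.Δφ 0 D.gφp ∧
    (∀ i, IsConformalBlock3D 0 0 (D.ΔS i) (D.ℓS i) (D.gS i)) ∧
    (∀ i, IsConformalBlock3D 0 0 (D.ΔT i) (D.ℓT i) (D.gT i)) ∧
    (∀ i, IsConformalBlock3D 0 0 (D.ΔA i) (D.ℓA i) (D.gA i)) ∧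
    (∀ j, IsConformalBlock3D D.Δφs D.Δφs (D.ΔV j) (D.ℓV j) (D.gVm j)) ∧
      ∀ j, IsConformalBlock3D (-D.Δφs) D.Δφs (D.ΔV j) (D.ℓV j) (D.gVp j)

/-- **A1 — unitarity (spectral part).** `Δ_φ, Δ_s ≥ 1/2`; every exchanged primary obeys the 3D unitarity
bound "`Δ ≥ ℓ + D − 2` (`ℓ > 0`), `Δ ≥ (D−2)/2` (`ℓ = 0`), `D = 3`"; singlets and traceless symmetric
tensors of `φ×φ` (and of `s×s`) have even spin, antisymmetric tensors odd spin, vectors of `φ×s` any spin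
(source §2.1 "`S, ℓ⁺`", "`T, ℓ⁺`", "`A, ℓ⁻`", "`V, ℓ^±`"; §2.2, the unitarity bound).  Positivity of the OPE
data is built into the structure: the couplings are real, so `λ² ≥ 0` and the singlet matrices
`(λ_{φφ𝒪}, λ_{ss𝒪})ᵀ(λ_{φφ𝒪}, λ_{ss𝒪})` are PSD. [cite: KosPolandSimmonsDuffinVichi2015, §2.2 (functional conditions)] -/
def SatisfiesUnitarity (D : ArchipelagoData N) : Prop :=
  1 / 2 ≤ D.Δφ ∧ 1 / 2 ≤ D.Δs ∧
    (∀ i, unitarityBound3D (D.ℓS i) ≤ D.ΔS i ∧ Even (D.ℓS i)) ∧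
    (∀ i, unitarityBound3D (D.ℓT i) ≤ D.ΔT i ∧ Even (D.ℓT i)) ∧
    (∀ i, unitarityBound3D (D.ℓA i) ≤ D.ΔA i ∧ Odd (D.ℓA i)) ∧
      ∀ j, unitarityBound3D (D.ℓV j) ≤ D.ΔV j

/-- **A1 — convergence clause** (exactly as retyped in the `σ–ε` file, REFEREE F39): at every real
diagonal point `z = z̄ = x ∈ (0,1)` the block expansions of the reflection-positive configurations
converge with the squared couplings as weights — `⟨φφφφ⟩` sector by sector (`Σ_S λ_{φφ𝒪}² g`, `Σ_T λ² g`,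
`Σ_A λ² g`), `⟨ssss⟩` (`Σ_S λ_{ss𝒪}² g`) and `⟨sφφs⟩` (`Σ_V λ² g^{-Δ_φs,Δ_φs}`).  Source of the clause
(identical scalars): "the conformal block decomposition converges exponentially fast for each `z` in the
unit disc" (Pappadopulo–Rychkov–Espin–Rattazzi 2012, §5.1; the Hilbert-space argument of §4.1 applies to
`⟨s|φ(x₃)φ(x₂)|s⟩` verbatim).  Point-evaluation functionals need no convergence clause at all; it is the
hypothesis of derivative functionals.  No clause on the `a = -b` family `gVm` (`⟨φsφs⟩`, not reflection
positive on the diagonal). [cite: PappadopuloRychkovEspinRattazzi2012, §4.1, §5.1] -/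
def HasConvergentWeights (D : ArchipelagoData N) : Prop :=
  ∀ x : ℝ, 0 < x → x < 1 →
    Summable (fun i => D.lamφφS i ^ 2 * D.gS i x x) ∧ Summable (fun i => D.lamT i ^ 2 * D.gT i x x) ∧
      Summable (fun i => D.lamA i ^ 2 * D.gA i x x) ∧ Summable (fun i => D.lamssS i ^ 2 * D.gS i x x) ∧
        Summable (fun j => D.lamV j ^ 2 * D.gVp j x x)

/-- **A3 — crossing: the seven sum rules**, at every real `z, z̄ ∈ (0,1)`, as `HasSum` identities, with
`F⁻ₓ[g] = crossF x (-1) g z z̄`, `F⁺ₓ[g] = crossF x 1 g z z̄` (`= v^x g(z,z̄) ∓ u^x g(1-z,1-z̄)`),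
`h = (Δ_φ+Δ_s)/2`, the identity (`λ = 1`, block `1`) and the external operators (`s` in rows 2, 3, 4, 6, 7;
`φ` in rows 5, 6, 7) written out, and the sectors of one row required to converge separately (they do,
absolutely, in any unitary CFT on the square):
1. `0 = Σ_T λ² F⁻_{Δφ}[g] − Σ_A λ² F⁻_{Δφ}[g]`;
2. `0 = F⁻_{Δφ}[1] + λ_{φφs}² F⁻_{Δφ}[gs] + Σ_S λ_{φφ𝒪}² F⁻_{Δφ}[g] + (1 − 2/N) Σ_T λ² F⁻_{Δφ}[g] + Σ_A λ² F⁻_{Δφ}[g]`;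
3. `0 = F⁺_{Δφ}[1] + λ_{φφs}² F⁺_{Δφ}[gs] + Σ_S λ_{φφ𝒪}² F⁺_{Δφ}[g] − (1 + 2/N) Σ_T λ² F⁺_{Δφ}[g] − Σ_A λ² F⁺_{Δφ}[g]`
   — rows 1–3 are `⟨φφφφ⟩` in the 2014 convention `V_S = (0,F⁻,F⁺)`, `V_T = (F⁻,(1−2/N)F⁻,−(1+2/N)F⁺)`,
   `V_A = (−F⁻,F⁻,−F⁺)` (module docstring (i); the source's rows with `G_A ↦ −G_A`);
4. `0 = F⁻_{Δs}[1] + λ_{sss}² F⁻_{Δs}[gs] + Σ_S λ_{ss𝒪}² F⁻_{Δs}[g]` (`⟨ssss⟩`);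
5. `0 = λ_{φsφ}² F⁻_h[gφm] + Σ_V (−1)^ℓ λ² F⁻_h[gVm]` (`⟨φsφs⟩`, block family `g^{Δ_φs,Δ_φs}`; the
   spin-parity sign placed as in the `σ–ε` ERRATUM, module docstring (ii));
6. `0 = F⁻_h[1] + λ_{φφs}λ_{sss} F⁻_h[gs] + Σ_S λ_{φφ𝒪}λ_{ss𝒪} F⁻_h[g] + λ_{φsφ}² F⁻_{Δφ}[gφp] + Σ_V λ² F⁻_{Δφ}[gVp]`;
7. `0 = F⁺_h[1] + λ_{φφs}λ_{sss} F⁺_h[gs] + Σ_S λ_{φφ𝒪}λ_{ss𝒪} F⁺_h[g] − λ_{φsφ}² F⁺_{Δφ}[gφp] − Σ_V λ² F⁺_{Δφ}[gVp]`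
   (`⟨φφss⟩` symmetrised/antisymmetrised with its crossed form `⟨sφφs⟩`, family `g^{-Δ_φs,Δ_φs}`).
These are the source's seven equations / `V⃗`-vectors (§2.1) written for the `c_ℓ = 1` blocks of A2; rows
5–7 are rules 3–5 of `SigmaEpsilonData.SatisfiesCrossing` with `(σ, ε) ↦ (φ, s)`.
[cite: KosPolandSimmonsDuffinVichi2015, §2.1 (seven equations; `V⃗_T, V⃗_A, V⃗_V, V⃗_S`)] -/
def SatisfiesCrossing (D : ArchipelagoData N) : Prop :=
  ∀ z zb : ℝ, z ∈ Ioo (0 : ℝ) 1 → zb ∈ Ioo (0 : ℝ) 1 →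
    -- row 1
    (∃ ST SA : ℝ,
      HasSum (fun i => D.lamT i ^ 2 * crossF D.Δφ (-1) (D.gT i) z zb) ST ∧
        HasSum (fun i => D.lamA i ^ 2 * crossF D.Δφ (-1) (D.gA i) z zb) SA ∧ ST - SA = 0) ∧
    -- row 2
    (∃ SS ST SA : ℝ,
      HasSum (fun i => D.lamφφS i ^ 2 * crossF D.Δφ (-1) (D.gS i) z zb) SS ∧
        HasSum (fun i => D.lamT i ^ 2 * crossF D.Δφ (-1) (D.gT i) z zb) ST ∧
        HasSum (fun i => D.lamA i ^ 2 * crossF D.Δφ (-1) (D.gA i) z zb) SA ∧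
          crossF D.Δφ (-1) (fun _ _ => 1) z zb + D.lamφφs ^ 2 * crossF D.Δφ (-1) D.gs z zb + SS +
            (1 - 2 / (N : ℝ)) * ST + SA = 0) ∧
    -- row 3
    (∃ SS ST SA : ℝ,
      HasSum (fun i => D.lamφφS i ^ 2 * crossF D.Δφ 1 (D.gS i) z zb) SS ∧
        HasSum (fun i => D.lamT i ^ 2 * crossF D.Δφ 1 (D.gT i) z zb) ST ∧
        HasSum (fun i => D.lamA i ^ 2 * crossF D.Δφ 1 (D.gA i) z zb) SA ∧
          crossF D.Δφ 1 (fun _ _ => 1) z zb + D.lamφφs ^ 2 * crossF D.Δφ 1 D.gs z zb + SS -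
            (1 + 2 / (N : ℝ)) * ST - SA = 0) ∧
    -- row 4
    HasSum (fun i => D.lamssS i ^ 2 * crossF D.Δs (-1) (D.gS i) z zb)
      (-(crossF D.Δs (-1) (fun _ _ => 1) z zb + D.lamsss ^ 2 * crossF D.Δs (-1) D.gs z zb)) ∧
    -- row 5
    HasSum (fun j => (-1 : ℝ) ^ D.ℓV j * D.lamV j ^ 2 * crossF D.Δh (-1) (D.gVm j) z zb)
      (-(D.lamφsφ ^ 2 * crossF D.Δh (-1) D.gφm z zb)) ∧
    -- row 6
    (∃ SS SV : ℝ,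
      HasSum (fun i => D.lamφφS i * D.lamssS i * crossF D.Δh (-1) (D.gS i) z zb) SS ∧
        HasSum (fun j => D.lamV j ^ 2 * crossF D.Δφ (-1) (D.gVp j) z zb) SV ∧
          crossF D.Δh (-1) (fun _ _ => 1) z zb + D.lamφφs * D.lamsss * crossF D.Δh (-1) D.gs z zb + SS +
            D.lamφsφ ^ 2 * crossF D.Δφ (-1) D.gφp z zb + SV = 0) ∧
    -- row 7
    ∃ SS SV : ℝ,
      HasSum (fun i => D.lamφφS i * D.lamssS i * crossF D.Δh 1 (D.gS i) z zb) SS ∧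
        HasSum (fun j => D.lamV j ^ 2 * crossF D.Δφ 1 (D.gVp j) z zb) SV ∧
          crossF D.Δh 1 (fun _ _ => 1) z zb + D.lamφφs * D.lamsss * crossF D.Δh 1 D.gs z zb + SS -
            D.lamφsφ ^ 2 * crossF D.Δφ 1 D.gφp z zb - SV = 0

/-- **A4 — the gap assumptions** against the thresholds `A`: singlet scalars other than `s` have
`Δ ≥ Δ_S^*`, vector scalars other than `φ` have `Δ ≥ Δ_V^*`, traceless-symmetric scalars have `Δ ≥ Δ_T^*`
(source §2.2 bullets and eq. (example): "`Δ ≥ D, ℓ = 0`" in the `V` and `S` lines).  No twist gap, no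
current / stress-tensor assumption. [cite: KosPolandSimmonsDuffinVichi2015, §2.2 (assumptions; eq. example)] -/
def SatisfiesGaps (D : ArchipelagoData N) (A : ArchipelagoGaps) : Prop :=
  (∀ i, D.ℓS i = 0 → A.ΔSstar ≤ D.ΔS i) ∧ (∀ j, D.ℓV j = 0 → A.ΔVstar ≤ D.ΔV j) ∧
    ∀ i, D.ℓT i = 0 → A.ΔTstar ≤ D.ΔT i

/-- **A5 — symmetry of the external OPE coefficient**: "`λ_{φφs} = λ_{φsφ}`.  This is a trivial consequence
of conformal invariance" (source §2.2), meaningful for the A2 blocks because their normalisation constant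
is `Δ`- and `(Δ₁₂,Δ₃₄)`-independent (module docstring (iii)).  The island of §3 needs it ("Adding this
constraint gives the dark blue region … We now have a closed island"); an enclosure proved without using
it is an enclosure under these axioms a fortiori. [cite: KosPolandSimmonsDuffinVichi2015, §2.2 (OPE-coefficient symmetry)] -/
def OPESymmetric (D : ArchipelagoData N) : Prop :=
  D.lamφsφ = D.lamφφs

/-- **The typed archipelago axioms A1–A5** against the thresholds `A`: genuine blocks, unitarity bounds
and spin parities, convergent weights, the seven crossing sum rules, the gaps, and `λ_{φsφ} = λ_{φφs}`.
[cite: KosPolandSimmonsDuffinVichi2015, §2.2 (functional conditions)] -/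
def SatisfiesBootstrapAxioms (D : ArchipelagoData N) (A : ArchipelagoGaps) : Prop :=
  D.HasGenuineBlocks ∧ D.SatisfiesUnitarity ∧ D.HasConvergentWeights ∧ D.SatisfiesCrossing ∧
    D.SatisfiesGaps A ∧ D.OPESymmetric

/-- Weaker thresholds are implied: `SatisfiesGaps` is antitone in each threshold. [cite: KosPolandSimmonsDuffinVichi2015, §2.2 (assumptions; eq. example)] -/
theorem SatisfiesGaps.of_le {D : ArchipelagoData N} {A A' : ArchipelagoGaps} (h : D.SatisfiesGaps A)
    (hS : A'.ΔSstar ≤ A.ΔSstar) (hV : A'.ΔVstar ≤ A.ΔVstar) (hT : A'.ΔTstar ≤ A.ΔTstar) :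
    D.SatisfiesGaps A' :=
  ⟨fun i hi => hS.trans (h.1 i hi), fun j hj => hV.trans (h.2.1 j hj), fun i hi => hT.trans (h.2.2 i hi)⟩

/-- The same for the conjoined axioms. [cite: KosPolandSimmonsDuffinVichi2015, §2.2 (assumptions; eq. example)] -/
theorem SatisfiesBootstrapAxioms.of_le {D : ArchipelagoData N} {A A' : ArchipelagoGaps}
    (h : D.SatisfiesBootstrapAxioms A) (hS : A'.ΔSstar ≤ A.ΔSstar) (hV : A'.ΔVstar ≤ A.ΔVstar)
    (hT : A'.ΔTstar ≤ A.ΔTstar) : D.SatisfiesBootstrapAxioms A' :=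
  ⟨h.1, h.2.1, h.2.2.1, h.2.2.2.1, h.2.2.2.2.1.of_le hS hV hT, h.2.2.2.2.2⟩

/-- With no assumption at all (`Δ^* = 1/2` in every slot) A4 follows from A1.
[cite: KosPolandSimmonsDuffinVichi2015, §2.2 (functional conditions)] -/
theorem satisfiesGaps_half {D : ArchipelagoData N} (h : D.SatisfiesUnitarity) :
    D.SatisfiesGaps ⟨1 / 2, 1 / 2, 1 / 2⟩ := by
  refine ⟨fun i hi => ?_, fun j hj => ?_, fun i hi => ?_⟩
  · have := (h.2.2.1 i).1; rwa [hi, show unitarityBound3D 0 = 1 / 2 by simp [unitarityBound3D]] at this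
  · have := h.2.2.2.2.2 j; rwa [hj, show unitarityBound3D 0 = 1 / 2 by simp [unitarityBound3D]] at this
  · have := (h.2.2.2.1 i).1; rwa [hi, show unitarityBound3D 0 = 1 / 2 by simp [unitarityBound3D]] at this

end ArchipelagoData

/-! ### §2 The windowed enclosure statement and its assembly from excluded boxes -/

/-- **Windowed enclosure.** `ArchipelagoEnclosure N A W R`: every `O(N)` archipelago datum satisfying
A1–A5 against the thresholds `A` whose `(Δ_φ, Δ_s)` lies in the window `W` has `(Δ_φ, Δ_s) ∈ R`.  The
window is essential (generalised free fields satisfy A1–A5 with suitable thresholds; the single-correlator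
bounds leave an allowed bulk region, source §3.1).  The printed islands (§3: `O(2)`, `O(3)`, `O(4)` at
`Λ = 19, 27, 35`) are floating-point SDPB results, not instances of this predicate; a certified
instance is what rational dual-functional certificates prove, box by box.
[cite: KosPolandSimmonsDuffinVichi2015, §3.1 (O(2): gaps, OPE symmetry, closed island)] -/
def ArchipelagoEnclosure (N : ℕ) (A : ArchipelagoGaps) (W R : Set (ℝ × ℝ)) : Prop :=
  ∀ D : ArchipelagoData N, D.SatisfiesBootstrapAxioms A → (D.Δφ, D.Δs) ∈ W → (D.Δφ, D.Δs) ∈ R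

/-- A box `Q` of `(Δ_φ, Δ_s)` is *excluded* (against `A`) if no datum satisfying the axioms has
`(Δ_φ, Δ_s) ∈ Q` — the content of one certified functional `α⃗ = (α₁, …, α₇)` (source §2.2: "If such a
functional exists for a hypothetical CFT spectrum, then that spectrum is inconsistent with crossing
symmetry"). [cite: KosPolandSimmonsDuffinVichi2015, §2.2 (functional conditions)] -/
def BoxExcluded (N : ℕ) (A : ArchipelagoGaps) (Q : Set (ℝ × ℝ)) : Prop :=
  ∀ D : ArchipelagoData N, D.SatisfiesBootstrapAxioms A → (D.Δφ, D.Δs) ∉ Q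

namespace ArchipelagoEnclosure

variable {N : ℕ} {A A' : ArchipelagoGaps} {W W' W₁ W₂ R R' R₁ R₂ : Set (ℝ × ℝ)}

/-- Monotonicity: a smaller window, a larger region. [cite: KosPolandSimmonsDuffinVichi2015, §2.2 (functional conditions)] -/
theorem mono (h : ArchipelagoEnclosure N A W R) (hW : W' ⊆ W) (hR : R ⊆ R') :
    ArchipelagoEnclosure N A W' R' :=
  fun D hD hmem => hR (h D hD (hW hmem))

/-- Monotonicity in the thresholds: an enclosure proved under WEAKER gap assumptions holds under stronger
ones ("Additional information about the spectrum can weaken the above constraints, making the search for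
the functional `α⃗` easier", source §2.2). [cite: KosPolandSimmonsDuffinVichi2015, §2.2 (assumptions; eq. example)] -/
theorem of_le (h : ArchipelagoEnclosure N A' W R) (hS : A'.ΔSstar ≤ A.ΔSstar) (hV : A'.ΔVstar ≤ A.ΔVstar)
    (hT : A'.ΔTstar ≤ A.ΔTstar) : ArchipelagoEnclosure N A W R :=
  fun D hD hmem => h D (hD.of_le hS hV hT) hmem

/-- Two enclosures on the same window intersect. [cite: KosPolandSimmonsDuffinVichi2015, §2.2 (functional conditions)] -/
theorem inter (h₁ : ArchipelagoEnclosure N A W R₁) (h₂ : ArchipelagoEnclosure N A W R₂) :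
    ArchipelagoEnclosure N A W (R₁ ∩ R₂) :=
  fun D hD hmem => ⟨h₁ D hD hmem, h₂ D hD hmem⟩

/-- Enclosures glue along a union of windows. [cite: KosPolandSimmonsDuffinVichi2015, §2.2 (functional conditions)] -/
theorem union (h₁ : ArchipelagoEnclosure N A W₁ R) (h₂ : ArchipelagoEnclosure N A W₂ R) :
    ArchipelagoEnclosure N A (W₁ ∪ W₂) R :=
  fun D hD hmem => hmem.elim (h₁ D hD) (h₂ D hD)

end ArchipelagoEnclosure

namespace BoxExcluded

variable {N : ℕ} {A A' : ArchipelagoGaps} {Q Q' : Set (ℝ × ℝ)}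

/-- An excluded box is an enclosure with empty region. [cite: KosPolandSimmonsDuffinVichi2015, §2.2 (functional conditions)] -/
theorem enclosure (h : BoxExcluded N A Q) : ArchipelagoEnclosure N A Q ∅ :=
  fun D hD hmem => (h D hD hmem).elim

/-- Sub-boxes of an excluded box are excluded. [cite: KosPolandSimmonsDuffinVichi2015, §2.2 (functional conditions)] -/
theorem mono (h : BoxExcluded N A Q) (hQ : Q' ⊆ Q) : BoxExcluded N A Q' :=
  fun D hD hmem => h D hD (hQ hmem)

/-- Excluded boxes are closed under union. [cite: KosPolandSimmonsDuffinVichi2015, §2.2 (functional conditions)] -/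
theorem union (h : BoxExcluded N A Q) (h' : BoxExcluded N A Q') : BoxExcluded N A (Q ∪ Q') :=
  fun D hD hmem => hmem.elim (h D hD) (h' D hD)

/-- Monotonicity in the thresholds. [cite: KosPolandSimmonsDuffinVichi2015, §2.2 (assumptions; eq. example)] -/
theorem of_le (h : BoxExcluded N A' Q) (hS : A'.ΔSstar ≤ A.ΔSstar) (hV : A'.ΔVstar ≤ A.ΔVstar)
    (hT : A'.ΔTstar ≤ A.ΔTstar) : BoxExcluded N A Q :=
  fun D hD hmem => h D (hD.of_le hS hV hT) hmem

end BoxExcluded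

/-- **Assembly of a certificate**: if `W ⊆ R ∪ ⋃ᵢ Qᵢ` and every `Qᵢ` is excluded, then
`ArchipelagoEnclosure N A W R` — the island `R` is what is left of the window after the certified boxes are
removed. [cite: KosPolandSimmonsDuffinVichi2015, §3.1 (O(2): gaps, OPE symmetry, closed island)] -/
theorem archipelagoEnclosure_of_cover {N : ℕ} {A : ArchipelagoGaps} {ι : Type*} {W R : Set (ℝ × ℝ)}
    (Q : ι → Set (ℝ × ℝ)) (hcov : W ⊆ R ∪ ⋃ i, Q i) (hQ : ∀ i, BoxExcluded N A (Q i)) :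
    ArchipelagoEnclosure N A W R := by
  intro D hD hmem
  rcases hcov hmem with hR | hQ'
  · exact hR
  · obtain ⟨i, hi⟩ := Set.mem_iUnion.mp hQ'
    exact ((hQ i) D hD hi).elim

end

end Literature.MathematicalPhysics.QuantumFieldTheory.ONArchipelagoSystem
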